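import Literature.NumberTheory.LFunctions.NoRealZeroEvenSmallModuli
import Literature.NumberTheory.LFunctions.NoRealZeroOddSmallModuliII
import HarnessLib

/-!
# The kernel base of the no-real-zero column, both parities: `NoRealZeroUpTo 231`, unconditionally

Topic `Literature/NumberTheory/LFunctions`; namespace `Literature.NumberTheory.LFunctions`. THEOREMS only.
Joins the two Fekete–Pólya small-moduli files: even conductors `≤ 292` (`noRealZeroEvenUpTo_292`,
`NoRealZeroEvenSmallModuli.lean`) and odd conductors `≤ 231` (`noRealZeroOddUpTo_231`,
`NoRealZeroOddSmallModuliII.lean`) give **`noRealZeroUpTo_231 : NoRealZeroUpTo 231`** — for every modulus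
`3 ≤ q ≤ 231`, every primitive quadratic Dirichlet character `χ` mod `q` and every `σ ∈ (0, 1)`,
`L(σ, χ) ≠ 0` — with no named fact (previous both-parity base: `163`, `noRealZeroUpTo_163`; before this
session `52`). `231` is the frontier of partial-sum positivity here: `d = −232, −235, −267` admit no
Fekete–Pólya certificate of order `≤ 3` through small induced moduli (Heilbronn's phenomenon at class
number `2`); going further needs Low's Epstein-sum method.

## References

* H. L. Montgomery, R. C. Vaughan, *Multiplicative Number Theory I*, CUP 2007, §11.2.1 Exercises 7–8.
  [MontgomeryVaughan2007]
* J. B. Rosser, *Real roots of real Dirichlet L-series*, J. Research Nat. Bur. Standards 45 (1950)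
  505–514. [Rosser1950RealRoots]
-/

namespace Literature.NumberTheory.LFunctions

/-- **`NoRealZeroUpTo 231`, both parities, unconditionally** (odd base `231`, even base `292`).
[cite: MontgomeryVaughan2007, §11.2.1 Exercises 7 (g), 8] -/
theorem noRealZeroUpTo_231 : NoRealZeroUpTo 231 :=
  NoRealZeroUpTo.iff_odd_and_even.mpr
    ⟨noRealZeroOddUpTo_231,
      fun q _ hq3 hq χ hquad hprim heven σ hσ0 hσ1 ↦
        noRealZeroEvenUpTo_292 q hq3 (by omega) χ hquad hprim heven σ hσ0 hσ1⟩

/-- `NoExceptionalZeroUpTo 231 c` for every `c`: the named-fact-free base below which a certificate table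
need not fire. [cite: MontgomeryVaughan2007, §11.2.1 Exercise 7] -/
theorem noExceptionalZeroUpTo_231 (c : ℝ) : NoExceptionalZeroUpTo 231 c :=
  noRealZeroUpTo_231.noExceptionalZeroUpTo c

/-- The kernel bases after this file: `NoRealZeroEvenUpTo 292 ∧ NoRealZeroOddUpTo 231`.
[cite: MontgomeryVaughan2007, §11.2.1 Exercise 7] -/
theorem noRealZero_kernelBase_292_231 : NoRealZeroEvenUpTo 292 ∧ NoRealZeroOddUpTo 231 :=
  ⟨noRealZeroEvenUpTo_292, noRealZeroOddUpTo_231⟩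

end Literature.NumberTheory.LFunctions
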